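import Mathlib

/-!
# Frame dichotomy along a bond (line `Sketch`, stub S4 `stub_frameDichotomy`)

Crux `StackingFaultSparsity` (stmt-AtomisticToContinuum-14296, routes `LaminarSixThreeThree` /
`SquareWellLayerCake`), line `Sketch`, reshape 11, stub S4 (registered name and signature).

An exact (`ε = 0`) local frame of a point set `X ⊂ ℝ³` at `p ∈ X` (lengths `a, b ∈ [19/20, 1]`, unit
normal `n`, levels `c : ℤ → ℝ`, `c 0 = 0`, gaps `≥ 19/25`) records: the closed unit shell of `p`
is exactly hexagon (6 points, height `0`, distance `a`) ∪ up-triple ∪ down-triple (3 + 3 points,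
heights `c (±1)`, distance `b`), and every shell point `q` of `p` has, in `p`'s frame, 6 level-mates
at distance `a`, 3 points one level up and 3 one level down at distance `b`.

`stub_frameDichotomy`: if `p ≠ q` are bonded (`dist p q ≤ 1`) and both carry exact frames
`(a, b, n, c)`, `(a', b', n', c')`, then `a' = a`, `b' = b`, and if `a ≠ b` then `n' = ± n`.

Proof.  The twelve `p`-frame neighbours `S = H' ∪ U' ∪ D'` of `q` (pairwise disjoint by their
`p`-heights, the levels being strictly increasing) lie in the closed unit shell of `q`, which
`q`'s frame says is `T = H_q ∪ U_q ∪ D_q` (at most 12 points); so `S = T` as finsets.  Reading the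
distances from `q` on both sides gives `a, b ∈ {a', b'}` and `a', b' ∈ {a, b}`, which settles the
case `a = b`.
For `a ≠ b` the only bad branch is `a' = b`, `b' = a`: then the up-triple `U'` sits inside the
`q`-hexagon `H_q`, i.e. three distinct points at distance `b` from `q` lie on the two planes
`⟪· - q, n⟫ = c (k+1) - c k ≠ 0` and `⟪· - q, n'⟫ = 0`; the elementary lemma
`normal_eq_or_eq_neg_of_finset` (three distinct points of a sphere about `q` never lie on a common
line — here the line `{⟪·, n⟫ = g} ∩ {⟪·, n'⟫ = 0}` when `n, n'` are independent, using
`finrank (span {n, n'})ᗮ = 3 - 2 = 1`) forces `n' = ± n`, contradicting the two heights.  With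
`a' = a`, `b' = b`, `a ≠ b` the `q`-hexagon lies inside `H'` (height `0` for both `n` and `n'`), and
the same lemma gives `n' = ± n`.  Mathlib only; everything here is `[folklore]` bookkeeping.
-/

noncomputable section

namespace Summit.AtomisticToContinuum.Crystallization.Theorems.SquareWellLayerCake.StackingFaultSparsity.LocalFrames.Dichotomy

open Module

/-- In `ℝ³`: if `x, y` are linearly independent and `u ≠ 0`, `w` are both orthogonal to `x` and to
`y`, then `w` is a real multiple of `u` (`(span {x, y})ᗮ` has dimension `3 - 2 = 1`). [folklore] -/
theorem exists_smul_of_orthogonal_pair (x y u w : EuclideanSpace ℝ (Fin 3))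
    (hxy : LinearIndependent ℝ ![x, y]) (hux : inner ℝ u x = 0) (huy : inner ℝ u y = 0)
    (hwx : inner ℝ w x = 0) (hwy : inner ℝ w y = 0) (hu : u ≠ 0) : ∃ t : ℝ, w = t • u := by
  have hK : finrank ℝ (Submodule.span ℝ (Set.range ![x, y])) = 2 := by
    rw [finrank_span_eq_card hxy, Fintype.card_fin]
  have hKo : finrank ℝ (Submodule.span ℝ (Set.range ![x, y]))ᗮ = 1 := by
    have h := Submodule.finrank_add_finrank_orthogonal (Submodule.span ℝ (Set.range ![x, y]))
    rw [finrank_euclideanSpace_fin, hK] at h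
    omega
  have hmem : ∀ v : EuclideanSpace ℝ (Fin 3), inner ℝ v x = 0 → inner ℝ v y = 0 →
      v ∈ (Submodule.span ℝ (Set.range ![x, y]))ᗮ := by
    intro v hx hy
    rw [Submodule.mem_orthogonal']
    intro z hz
    obtain ⟨c, rfl⟩ := (Submodule.mem_span_range_iff_exists_fun ℝ).1 hz
    simp [Fin.sum_univ_two, inner_add_right, inner_smul_right, hx, hy]
  have hu' : (⟨u, hmem u hux huy⟩ : (Submodule.span ℝ (Set.range ![x, y]))ᗮ) ≠ 0 := fun h =>
    hu (by simpa using congrArg Subtype.val h)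
  obtain ⟨t, ht⟩ := (finrank_eq_one_iff_of_nonzero' _ hu').1 hKo ⟨w, hmem w hwx hwy⟩
  exact ⟨t, by simpa using (congrArg Subtype.val ht).symm⟩

/-- If `‖v + x‖ = ‖v‖` and `‖v + t • x‖ = ‖v‖` then `t • x = 0` or `t = 1`: the line `v + ℝ x`
meets the sphere of radius `‖v‖` about `0` only at the parameters `0` and `1`. [folklore] -/
theorem smul_eq_zero_or_eq_one (v x : EuclideanSpace ℝ (Fin 3)) (t : ℝ) (h2 : ‖v + x‖ = ‖v‖)
    (h3 : ‖v + t • x‖ = ‖v‖) : t • x = 0 ∨ t = 1 := by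
  have h2' : ‖v + x‖ ^ 2 = ‖v‖ ^ 2 := by rw [h2]
  have h3' : ‖v + t • x‖ ^ 2 = ‖v‖ ^ 2 := by rw [h3]
  rw [norm_add_sq_real] at h2' h3'
  rw [real_inner_smul_right, norm_smul, mul_pow, Real.norm_eq_abs, sq_abs] at h3'
  have h : t * (t - 1) * ‖x‖ ^ 2 = 0 := by linear_combination h3' - t * h2'
  rcases mul_eq_zero.1 h with h | h
  · rcases mul_eq_zero.1 h with h | h
    · exact Or.inl (by rw [h, zero_smul])
    · exact Or.inr (by linarith)
  · exact Or.inl (by rw [show x = 0 by simpa using h, smul_zero])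

/-- Three distinct vectors of `ℝ³` of equal norm whose pairwise differences are orthogonal to two
linearly independent vectors `x, y` do not exist (a line meets a sphere in at most two points).
[folklore] -/
theorem false_of_three_on_line (x y v₁ v₂ v₃ : EuclideanSpace ℝ (Fin 3))
    (hxy : LinearIndependent ℝ ![x, y]) (h12 : v₁ ≠ v₂) (h13 : v₁ ≠ v₃) (h23 : v₂ ≠ v₃)
    (hn2 : ‖v₂‖ = ‖v₁‖) (hn3 : ‖v₃‖ = ‖v₁‖)
    (hx2 : inner ℝ v₂ x = inner ℝ v₁ x) (hx3 : inner ℝ v₃ x = inner ℝ v₁ x)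
    (hy2 : inner ℝ v₂ y = inner ℝ v₁ y) (hy3 : inner ℝ v₃ y = inner ℝ v₁ y) : False := by
  obtain ⟨t, ht⟩ := exists_smul_of_orthogonal_pair x y (v₂ - v₁) (v₃ - v₁) hxy
    (by rw [inner_sub_left, hx2, sub_self]) (by rw [inner_sub_left, hy2, sub_self])
    (by rw [inner_sub_left, hx3, sub_self]) (by rw [inner_sub_left, hy3, sub_self])
    (sub_ne_zero.2 h12.symm)
  have e2 : v₁ + (v₂ - v₁) = v₂ := by abel
  have e3 : v₁ + t • (v₂ - v₁) = v₃ := by rw [← ht]; abel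
  rcases smul_eq_zero_or_eq_one v₁ (v₂ - v₁) t (by rw [e2, hn2]) (by rw [e3, hn3]) with h | h
  · exact h13 (by rw [← e3, h, add_zero])
  · exact h23 (by rw [← e2, ← e3, h, one_smul])

/-- Two unit vectors which are neither equal nor opposite are linearly independent. [folklore] -/
theorem linearIndependent_of_norm_eq_one (n n' : EuclideanSpace ℝ (Fin 3)) (hn : ‖n‖ = 1)
    (hn' : ‖n'‖ = 1) (h1 : n' ≠ n) (h2 : n' ≠ -n) : LinearIndependent ℝ ![n, n'] := by
  rw [LinearIndependent.pair_iff' (norm_ne_zero_iff.1 (by rw [hn]; exact one_ne_zero))]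
  intro s hs
  have habs : |s| = 1 := by
    have h := congrArg (‖·‖) hs
    simp only [norm_smul, hn, hn', mul_one, Real.norm_eq_abs] at h
    exact h
  rcases (abs_eq zero_le_one).1 habs with rfl | rfl
  · exact h1 (by rw [← hs, one_smul])
  · exact h2 (by rw [← hs, neg_one_smul])

/-- **Plane rigidity of three shell points.**  If two unit vectors `n, n'` of `ℝ³` see more than two
points of a finset `F` on a sphere about `q` at constant heights (`⟪r - q, n⟫ = g`,
`⟪r - q, n'⟫ = 0` for `r ∈ F`), then `n' = n` or `n' = -n`: otherwise `n, n'` are independent and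
three distinct points of the sphere would lie on one line. [folklore] -/
theorem normal_eq_or_eq_neg_of_finset (n n' q : EuclideanSpace ℝ (Fin 3)) (g d : ℝ) (hn : ‖n‖ = 1)
    (hn' : ‖n'‖ = 1) (F : Finset (EuclideanSpace ℝ (Fin 3))) (hF : 2 < F.card)
    (h : ∀ r ∈ F, inner ℝ (r - q) n = g ∧ inner ℝ (r - q) n' = 0 ∧ dist q r = d) :
    n' = n ∨ n' = -n := by
  by_contra hc
  push Not at hc
  obtain ⟨r₁, h₁, r₂, h₂, r₃, h₃, h12, h13, h23⟩ := Finset.two_lt_card.1 hF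
  obtain ⟨g₁, z₁, d₁⟩ := h r₁ h₁
  obtain ⟨g₂, z₂, d₂⟩ := h r₂ h₂
  obtain ⟨g₃, z₃, d₃⟩ := h r₃ h₃
  refine false_of_three_on_line n n' (r₁ - q) (r₂ - q) (r₃ - q)
    (linearIndependent_of_norm_eq_one n n' hn hn' hc.1 hc.2) ?_ ?_ ?_ ?_ ?_ ?_ ?_ ?_ ?_
  · exact fun e => h12 (sub_left_inj.1 e)
  · exact fun e => h13 (sub_left_inj.1 e)
  · exact fun e => h23 (sub_left_inj.1 e)
  · rw [← dist_eq_norm, ← dist_eq_norm, dist_comm, d₂, dist_comm, d₁]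
  · rw [← dist_eq_norm, ← dist_eq_norm, dist_comm, d₃, dist_comm, d₁]
  · rw [g₂, g₁]
  · rw [g₃, g₁]
  · rw [z₂, z₁]
  · rw [z₃, z₁]

/-- **Frame dichotomy along a bond** (stub S4 `stub_frameDichotomy` of the line `Sketch`, crux
`StackingFaultSparsity`, registered signature).  Two exact local frames `(a, b, n, c)` at `p` and
`(a', b', n', c')` at `q` of the same point set `X ⊂ ℝ³`, at bonded points `p ≠ q`, `dist p q ≤ 1`,
have the same lengths, `a' = a` and `b' = b`, and if `a ≠ b` the same normal up to sign,
`n' = n ∨ n' = -n`.  Proof in the module docstring: the twelve `p`-frame neighbours of `q` ARE the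
`q`-shell; compare distances from `q`; the mixed branch and the normal are settled by
`normal_eq_or_eq_neg_of_finset`. [folklore] -/
theorem stub_frameDichotomy :
    ∀ (X : Set (EuclideanSpace ℝ (Fin 3))) (p q : EuclideanSpace ℝ (Fin 3)) (a b a' b' : ℝ) (n n' : EuclideanSpace ℝ (Fin 3)) (c c' : ℤ → ℝ), p ∈ X → q ∈ X → p ≠ q → dist p q ≤ 1 → (19 / 20 ≤ a ∧ a ≤ 1 ∧ 19 / 20 ≤ b ∧ b ≤ 1 ∧ ‖n‖ = 1 ∧ c 0 = 0 ∧ (∀ k : ℤ, c k + 19 / 25 ≤ c (k + 1)) ∧ (∀ q ∈ X, ∀ r ∈ X, q ≠ r → 19 / 20 ≤ dist q r) ∧ (∀ q ∈ X, dist q p < 2 → ∃ k : ℤ, inner ℝ (q - p) n = c k) ∧ (∃ H U D : Finset (EuclideanSpace ℝ (Fin 3)), H.card = 6 ∧ U.card = 3 ∧ D.card = 3 ∧ (∀ q ∈ H, q ∈ X ∧ inner ℝ (q - p) n = 0 ∧ dist p q = a) ∧ (∀ q ∈ U, q ∈ X ∧ inner ℝ (q - p) n = c 1 ∧ dist p q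 = b) ∧ (∀ q ∈ D, q ∈ X ∧ inner ℝ (q - p) n = c (-1) ∧ dist p q = b) ∧ (∀ q ∈ X, q ≠ p → dist q p ≤ 1 → q ∈ H ∨ q ∈ U ∨ q ∈ D)) ∧ (∀ q ∈ X, q ≠ p → dist q p ≤ 1 → (∃ H' : Finset (EuclideanSpace ℝ (Fin 3)), H'.card = 6 ∧ ∀ r ∈ H', r ∈ X ∧ r ≠ q ∧ inner ℝ (r - p) n = inner ℝ (q - p) n ∧ dist q r = a) ∧ (∃ U' : Finset (EuclideanSpace ℝ (Fin 3)), U'.card = 3 ∧ ∀ r ∈ U', r ∈ X ∧ (∃ k : ℤ, inner ℝ (q - p) n = c k ∧ inner ℝ (r - p) n = c (k + 1)) ∧ dist q r = b) ∧ (∃ D' : Finset (EuclideanSpace ℝ (Fin 3)), D'.card = 3 ∧ ∀ r ∈ D', r ∈ X ∧ (∃ k : ℤ, inner ℝ (q - p) n = c k ∧ inner ℝ (r - p) n = c (k - 1)) ∧ dist q r = b) ∧ (∀ r ∈ X, r ≠ q → dist q r < 1 → (inner ℝ (r - p) n = inner ℝ (q - p) n → dist q r = a) ∧ (inner ℝ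 (r - p) n ≠ inner ℝ (q - p) n → dist q r = b)))) → (19 / 20 ≤ a' ∧ a' ≤ 1 ∧ 19 / 20 ≤ b' ∧ b' ≤ 1 ∧ ‖n'‖ = 1 ∧ c' 0 = 0 ∧ (∀ k : ℤ, c' k + 19 / 25 ≤ c' (k + 1)) ∧ (∀ r ∈ X, ∀ t ∈ X, r ≠ t → 19 / 20 ≤ dist r t) ∧ (∀ r ∈ X, dist r q < 2 → ∃ k : ℤ, inner ℝ (r - q) n' = c' k) ∧ (∃ H U D : Finset (EuclideanSpace ℝ (Fin 3)), H.card = 6 ∧ U.card = 3 ∧ D.card = 3 ∧ (∀ r ∈ H, r ∈ X ∧ inner ℝ (r - q) n' = 0 ∧ dist q r = a') ∧ (∀ r ∈ U, r ∈ X ∧ inner ℝ (r - q) n' = c' 1 ∧ dist q r = b') ∧ (∀ r ∈ D, r ∈ X ∧ inner ℝ (r - q) n' = c' (-1) ∧ dist q r = b') ∧ (∀ r ∈ X, r ≠ q → dist r q ≤ 1 → r ∈ H ∨ r ∈ U ∨ r ∈ D)) ∧ (∀ r ∈ X, r ≠ q → dist r q ≤ 1 → (∃ H' : Finset (EuclideanSpace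 ℝ (Fin 3)), H'.card = 6 ∧ ∀ t ∈ H', t ∈ X ∧ t ≠ r ∧ inner ℝ (t - q) n' = inner ℝ (r - q) n' ∧ dist r t = a') ∧ (∃ U' : Finset (EuclideanSpace ℝ (Fin 3)), U'.card = 3 ∧ ∀ t ∈ U', t ∈ X ∧ (∃ k : ℤ, inner ℝ (r - q) n' = c' k ∧ inner ℝ (t - q) n' = c' (k + 1)) ∧ dist r t = b') ∧ (∃ D' : Finset (EuclideanSpace ℝ (Fin 3)), D'.card = 3 ∧ ∀ t ∈ D', t ∈ X ∧ (∃ k : ℤ, inner ℝ (r - q) n' = c' k ∧ inner ℝ (t - q) n' = c' (k - 1)) ∧ dist r t = b') ∧ (∀ t ∈ X, t ≠ r → dist r t < 1 → (inner ℝ (t - q) n' = inner ℝ (r - q) n' → dist r t = a') ∧ (inner ℝ (t - q) n' ≠ inner ℝ (r - q) n' → dist r t = b')))) → a' = a ∧ b' = b ∧ (a ≠ b → (n' = n ∨ n' = -n)) := by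
  intro X p q a b a' b' n n' c c' _ hqX hpq hpq1 hP hQ
  classical
  obtain ⟨-, ha2, hb1, hb2, hn, -, hgap, -, -, -, hsec⟩ := hP
  obtain ⟨-, -, -, -, hn', -, -, -, -, ⟨Hq, Uq, Dq, hHqc, hUqc, hDqc, hHq, hUq, hDq, hshq⟩, -⟩ := hQ
  obtain ⟨⟨H', hH'c, hH'⟩, ⟨U', hU'c, hU'⟩, ⟨D', hD'c, hD'⟩, -⟩ :=
    hsec q hqX hpq.symm (by rwa [dist_comm])
  -- the levels are strictly increasing; the level index `k₀` of `q`
  have hmono : StrictMono c := strictMono_int_of_lt_succ fun k => by have := hgap k; linarith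
  obtain ⟨u₀, hu₀⟩ : U'.Nonempty := Finset.card_pos.1 (by omega)
  obtain ⟨k₀, hqk, -⟩ := (hU' u₀ hu₀).2.1
  have hUh : ∀ r ∈ U', inner ℝ (r - p) n = c (k₀ + 1) := fun r hr => by
    obtain ⟨k, hk1, hk2⟩ := (hU' r hr).2.1
    rw [hk2, hmono.injective (hk1.symm.trans hqk)]
  have hDh : ∀ r ∈ D', inner ℝ (r - p) n = c (k₀ - 1) := fun r hr => by
    obtain ⟨k, hk1, hk2⟩ := (hD' r hr).2.1
    rw [hk2, hmono.injective (hk1.symm.trans hqk)]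
  have hHh : ∀ r ∈ H', inner ℝ (r - p) n = c k₀ := fun r hr => (hH' r hr).2.2.1.trans hqk
  have hk1 : c k₀ < c (k₀ + 1) := hmono (lt_add_one k₀)
  have hk2 : c (k₀ - 1) < c k₀ := hmono (sub_one_lt k₀)
  have hqd : ∀ r : EuclideanSpace ℝ (Fin 3),
      inner ℝ (r - q) n = inner ℝ (r - p) n - inner ℝ (q - p) n := fun r => by
    rw [← inner_sub_left, sub_sub_sub_cancel_right]
  -- `S = H' ∪ U' ∪ D'` has twelve points (pairwise disjoint by heights)
  have dHU : Disjoint H' U' := Finset.disjoint_left.2 fun r h1 h2 =>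
    hk1.ne ((hHh r h1).symm.trans (hUh r h2))
  have dHD : Disjoint H' D' := Finset.disjoint_left.2 fun r h1 h2 =>
    hk2.ne' ((hHh r h1).symm.trans (hDh r h2))
  have dUD : Disjoint U' D' := Finset.disjoint_left.2 fun r h1 h2 =>
    (hk2.trans hk1).ne' ((hUh r h1).symm.trans (hDh r h2))
  have hScard : (H' ∪ U' ∪ D').card = 12 := by
    rw [Finset.card_union_of_disjoint (Finset.disjoint_union_left.2 ⟨dHD, dUD⟩),
      Finset.card_union_of_disjoint dHU, hH'c, hU'c, hD'c]
  -- every point of `S` is a `q`-shell point, at distance `a` (on `H'`) or `b` (on `U' ∪ D'`)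
  have hmemS : ∀ r ∈ H' ∪ U' ∪ D', r ∈ X ∧ r ≠ q ∧ dist r q ≤ 1 ∧
      ((r ∈ H' ∧ dist q r = a) ∨ (r ∈ U' ∪ D' ∧ dist q r = b)) := by
    intro r hr
    simp only [Finset.mem_union] at hr ⊢
    rcases hr with (h | h) | h
    · obtain ⟨hrX, hrq, -, hd⟩ := hH' r h
      exact ⟨hrX, hrq, by rw [dist_comm, hd]; exact ha2, Or.inl ⟨h, hd⟩⟩
    · obtain ⟨hrX, -, hd⟩ := hU' r h
      exact ⟨hrX, fun e => by rw [e, dist_self] at hd; linarith, by rw [dist_comm, hd]; exact hb2,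
        Or.inr ⟨Or.inl h, hd⟩⟩
    · obtain ⟨hrX, -, hd⟩ := hD' r h
      exact ⟨hrX, fun e => by rw [e, dist_self] at hd; linarith, by rw [dist_comm, hd]; exact hb2,
        Or.inr ⟨Or.inr h, hd⟩⟩
  -- so `S ⊆ T = Hq ∪ Uq ∪ Dq`, and `T` has at most twelve points: `S = T`
  have hST : H' ∪ U' ∪ D' ⊆ Hq ∪ Uq ∪ Dq := fun r hr => by
    obtain ⟨hrX, hrq, hd, -⟩ := hmemS r hr
    have := hshq r hrX hrq hd
    simp only [Finset.mem_union]
    tauto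
  have hSeqT : H' ∪ U' ∪ D' = Hq ∪ Uq ∪ Dq := Finset.eq_of_subset_of_card_le hST (by
    calc (Hq ∪ Uq ∪ Dq).card ≤ (Hq ∪ Uq).card + Dq.card := Finset.card_union_le _ _
      _ ≤ Hq.card + Uq.card + Dq.card := by gcongr; exact Finset.card_union_le _ _
      _ = (H' ∪ U' ∪ D').card := by rw [hHqc, hUqc, hDqc, hScard])
  have hmemT : ∀ r ∈ Hq ∪ Uq ∪ Dq, (r ∈ Hq ∧ dist q r = a') ∨ (r ∈ Uq ∪ Dq ∧ dist q r = b') := by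
    intro r hr
    simp only [Finset.mem_union] at hr ⊢
    rcases hr with (h | h) | h
    · exact Or.inl ⟨h, (hHq r h).2.2⟩
    · exact Or.inr ⟨Or.inl h, (hUq r h).2.2⟩
    · exact Or.inr ⟨Or.inr h, (hDq r h).2.2⟩
  -- the four length inclusions `a, b ∈ {a', b'}`, `a', b' ∈ {a, b}`
  have L1 : a = a' ∨ a = b' := by
    obtain ⟨r, hr⟩ : H'.Nonempty := Finset.card_pos.1 (by omega)
    have hd : dist q r = a := (hH' r hr).2.2.2
    rcases hmemT r (hST (by simp [hr])) with ⟨-, h⟩ | ⟨-, h⟩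
    · exact Or.inl (hd.symm.trans h)
    · exact Or.inr (hd.symm.trans h)
  have L2 : b = a' ∨ b = b' := by
    have hd : dist q u₀ = b := (hU' u₀ hu₀).2.2
    rcases hmemT u₀ (hST (by simp [hu₀])) with ⟨-, h⟩ | ⟨-, h⟩
    · exact Or.inl (hd.symm.trans h)
    · exact Or.inr (hd.symm.trans h)
  have L3 : a' = a ∨ a' = b := by
    obtain ⟨r, hr⟩ : Hq.Nonempty := Finset.card_pos.1 (by omega)
    have hd : dist q r = a' := (hHq r hr).2.2
    have hrS : r ∈ H' ∪ U' ∪ D' := by rw [hSeqT]; simp [hr]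
    rcases (hmemS r hrS).2.2.2 with ⟨-, h⟩ | ⟨-, h⟩
    · exact Or.inl (hd.symm.trans h)
    · exact Or.inr (hd.symm.trans h)
  have L4 : b' = a ∨ b' = b := by
    obtain ⟨r, hr⟩ : Uq.Nonempty := Finset.card_pos.1 (by omega)
    have hd : dist q r = b' := (hUq r hr).2.2
    have hrS : r ∈ H' ∪ U' ∪ D' := by rw [hSeqT]; simp [hr]
    rcases (hmemS r hrS).2.2.2 with ⟨-, h⟩ | ⟨-, h⟩
    · exact Or.inl (hd.symm.trans h)
    · exact Or.inr (hd.symm.trans h)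
  by_cases hab : a = b
  · exact ⟨L3.elim id fun h => h.trans hab.symm, L4.elim (fun h => h.trans hab) id,
      fun h => absurd hab h⟩
  -- `a ≠ b`: first `a' = a` (the branch `a' = b`, `b' = a` puts `U'` inside the `q`-hexagon)
  have haa : a' = a := by
    by_contra hne
    have ha'b : a' = b := L3.resolve_left hne
    have hb'a : b' = a := by
      refine L4.resolve_right fun hb'b => ?_
      rcases L1 with h | h
      · exact hab (h.trans ha'b)
      · exact hab (h.trans hb'b)
    have key : ∀ r ∈ U', inner ℝ (r - q) n = c (k₀ + 1) - c k₀ ∧ inner ℝ (r - q) n' = 0 ∧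
        dist q r = b := by
      intro r hr
      have hd : dist q r = b := (hU' r hr).2.2
      refine ⟨by rw [hqd, hUh r hr, hqk], ?_, hd⟩
      rcases hmemT r (hST (by simp [hr])) with ⟨h, -⟩ | ⟨-, h⟩
      · exact (hHq r h).2.1
      · exact absurd (hd.symm.trans (h.trans hb'a)).symm hab
    rcases normal_eq_or_eq_neg_of_finset n n' q _ _ hn hn' U' (by omega) key with h | h
    · have h0 := (key u₀ hu₀).2.1
      rw [h, (key u₀ hu₀).1] at h0
      linarith
    · have h0 := (key u₀ hu₀).2.1
      rw [h, inner_neg_right, (key u₀ hu₀).1] at h0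
      linarith
  have hbb : b' = b := by
    refine L4.resolve_left fun hb'a => ?_
    rcases L2 with h | h
    · exact hab (h.trans haa).symm
    · exact hab (h.trans hb'a).symm
  refine ⟨haa, hbb, fun _ => ?_⟩
  -- the normal: the `q`-hexagon lies inside `H'`, at height `0` for both `n` and `n'`
  have key : ∀ r ∈ Hq, inner ℝ (r - q) n = 0 ∧ inner ℝ (r - q) n' = 0 ∧ dist q r = a' := by
    intro r hr
    obtain ⟨-, hz, hd⟩ := hHq r hr
    refine ⟨?_, hz, hd⟩
    have hrS : r ∈ H' ∪ U' ∪ D' := by rw [hSeqT]; simp [hr]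
    rcases (hmemS r hrS).2.2.2 with ⟨h, -⟩ | ⟨-, h⟩
    · rw [hqd, hHh r h, hqk, sub_self]
    · exact absurd (haa.symm.trans (hd.symm.trans h)) hab
  exact normal_eq_or_eq_neg_of_finset n n' q 0 a' hn hn' Hq (by omega) key

end Summit.AtomisticToContinuum.Crystallization.Theorems.SquareWellLayerCake.StackingFaultSparsity.LocalFrames.Dichotomy
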